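import Summits.Ventures.CertifiedManyBodySolver.Downfold.BoxesNdNiO2ELadderC
import HarnessLib

/-!
# NdNiO₂ object-E ladder, sequel D: the M22 TWIN (Nd₀.₈Sr₀.₂NiO₂ film, box `boxNdSrNiO2E_M22`, leaf «MOS2-ndnio2-M22») — the determination-hull
# sub-box `boxNdSrNiO2E_M22det`, the residual corner cell `boxNdSrNiO2E_M22res`, and the fact that they are DISJOINT (the M22 residual is padding-only)

Cell `pub/hubbard-downfold` (S1; D-0154 (1)(C) NdNiO₂), seat hubbard-cov-ndnio2-unc-2 (lane R-ma: object E). Sequel of `BoxesNdNiO2ELadderC` (M21: `boxNdNiO2E_M21det2`,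
`boxNdNiO2E_M21res`). The doped column M22 carries the parent's `U/t_eff`, `t′/t_eff`, `t_eff`, `t″` rows VERBATIM (family rows; first file §6), so its
determination rungs in those coordinates are M21's (`ndNiO2E_M21det_U/_tp/_t`); only the filling differs: the M22 `n` row of record `[359/500, 409/500] =
0.768 ± 0.05` is ONE DFT determination — the band count `ndNiO2Fill_count_x020 = 96/125` (cov-ndnio2-unc-3, `BoxesNdNiO2FillingLadder` §2; DFT:j257052) —
widened by the INFL-dop CLASS floor `±1/20`; the same leg's pocket bookkeeping gives `1 − 1/5 − ndNiO2Fill_pocket_x020 = 391/500 = 0.782`. This file takes the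
`n` determination rung CONSERVATIVELY as the hull of both DFT readings `[96/125, 391/500] = [0.768, 0.782]` (the row's cited member is `0.768` alone).
* §1 `boxNdSrNiO2E_M22det` (NOT a box of record) + mem_iff + `⊆ boxNdSrNiO2E_M22` + downward transfer + determination door (keyed to unc-3's literals) +
  corners + word door.
* §2 `boxNdSrNiO2E_M22res` = cov-ndnio2-box-2's M22 residual corner cell `t′/t ∈ [−23/50, −11/25] × U/t ∈ [5, 17/2] × n ∈ [393/500, 409/500]`
  (`Observables/RungLeavesCoverageNdNiO2Cut`: `…boxNdSrNiO2E_M22_of_cornerCellLeaf`; the rest of the M22 box is node-free kinematics `< 0.4418857`) as a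
  sub-box + mem_iff + `⊆ boxNdSrNiO2E_M22` + curried-cell word door.
* §3 **`boxNdSrNiO2E_M22res` and `boxNdSrNiO2E_M22det` are DISJOINT**: every point of the residual cell has `n ≥ 393/500 > 391/500 ≥` every `n`
  determination (gap `1/250` to the pocket reading, `9/500` to the band-count member of record) — unlike M21 (sequel C: a determination inside EACH M21
  residual slab), **the M22 residual corner cell is ENTIRELY INFL-dop class-floor padding in `n`**; exact gaps of the determination hull to the M22 binding
  corner `(5, −23/50, 409/500)`: `Δt′/t = 1/200`, `Δn = 9/250`, `ΔU/t = 315/1172`.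

PLANNING READING `[float]`, NOT typed (plan-1's `tools/kin_corner.py` bathtub `K(t′, n)`; M22 bar `0.4418857 = floor₇(0.98 × 0.4509038)`): `K(−0.46, 0.818) =
0.444819` (box corner, `+0.66 %`), `K(−0.455, 0.818) = 0.441884` (`−0.0004 %`, AT the bar: `K = bar` at `n = 0.8180` on `t′ = −0.455`), `K(−0.46, n) = bar` at
`n = 0.8078`, `K(−0.46, 0.786) = 0.435533` (`−1.44 %`), `K(−0.455, 0.782) = 0.431357` (`−2.38 %`), `K(−0.455, 0.768) = 0.427138` (det corner, `−3.34 %`,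
`bar − K = 0.0147`) ⇒ the M22 kinematically-open set `{K > bar}` lies in `t′ < −0.455` or `n > 0.8078` — padding on both axes — and a padding-free CONTROL word
`StiffnessBoxCeilingBelow boxNdSrNiO2E_M22det (4418857/10⁷)` is within reach of today's `M = 128` four-corner table (slack `≈ 0.006 < 0.0105`) at the corner
`(−91/200, 391/500)` — zero solve, cov-ndnio2-box-2's row machinery, if the captain wants it; nothing booked here.

Everything PROVED (no `sorry`). HONEST FRAMING: containment / width arithmetic on SCREENING-GRADE rows typed verbatim; det / res are NOT boxes of record nor statement
domains of record (the twin leaf «MOS2-ndnio2-M22» is on `boxNdSrNiO2E_M22`); the INFL-dop padding is S1's DECLARED uncertainty (ROUTER A5-i), not slack;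
`[float]` kinematics bound nothing; nothing about Nd₀.₈Sr₀.₂NiO₂ is certified; no hull, row, word, bar or box of record is edited; no summit statement is
proved by this file.
-/

noncomputable section

namespace Summit.Ventures.CertifiedManyBodySolver.Downfold

open Set NonemptyInterval

/-! ## §1 `boxNdSrNiO2E_M22det` — where the admitted determinations sit inside the M22 column box -/

/-- `n` determination rung of column M22 (x = 1/5 film): the hull of the two DFT readings of leg DFT:j257052 — band count `ndNiO2Fill_count_x020 = 96/125 =
0.768` (the row's cited member) and the pocket bookkeeping `1 − 1/5 − ndNiO2Fill_pocket_x020 = 391/500 = 0.782` — `= [96/125, 391/500]`. NOT an entry of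
record (that is `ndSrNiO2E_M22_n = [359/500, 409/500]`, the member `± 1/20` class floor). [folklore] -/
def ndSrNiO2E_M22det_n : Entry := Entry.ofEnds (96/125) (391/500) (by norm_num) .screening

/-- The rung's ends ARE unc-3's typed literals: `fst = ndNiO2Fill_count_x020`, `snd = 1 − 1/5 − ndNiO2Fill_pocket_x020`; and the row of record is the
band-count member `± 1/20` exactly. [folklore] -/
theorem ndSrNiO2E_M22det_n_ends :
    ndSrNiO2E_M22det_n.encl.fst = ndNiO2Fill_count_x020 ∧ ndSrNiO2E_M22det_n.encl.snd = 1 - 1/5 - ndNiO2Fill_pocket_x020 ∧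
      ndSrNiO2E_M22_n.encl.fst = ndNiO2Fill_count_x020 - 1/20 ∧ ndSrNiO2E_M22_n.encl.snd = ndNiO2Fill_count_x020 + 1/20 := by
  simp only [ndSrNiO2E_M22det_n, ndSrNiO2E_M22_n, ndNiO2Fill_count_x020, ndNiO2Fill_pocket_x020, Entry.encl_ofEnds_fst, Entry.encl_ofEnds_snd]
  norm_num

/-- **`boxNdSrNiO2E_M22det`** — the DETERMINATION-HULL sub-box of column M22, object E: `U/t_eff ∈ [6175/1172, 8000/959]`, `t′/t_eff ∈ [−91/200, −9/25]`,
`t_eff ∈ [959/2500, 293/625]` eV (the family rungs of M21), `n ∈ [96/125, 391/500]`, `t″ = 0`. NOT a box of record. [folklore] -/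
def boxNdSrNiO2E_M22det : OneBandBox := fun c =>
  match c with
  | .UOverT => some ndNiO2E_M21det_U
  | .tpOverT => some ndNiO2E_M21det_tp
  | .filling => some ndSrNiO2E_M22det_n
  | .tEV => some ndNiO2E_M21det_t
  | .tppOverT => some ndNiO2E_M21_tpp
  | _ => none

/-- **Membership in `boxNdSrNiO2E_M22det` unfolded.** [folklore] -/
theorem boxNdSrNiO2E_M22det_mem_iff (p : OneBandCoord → ℝ) :
    boxNdSrNiO2E_M22det.Mem p ↔
      (((6175/1172 : ℚ)) : ℝ) ≤ p .UOverT ∧ p .UOverT ≤ (((8000/959 : ℚ)) : ℝ) ∧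
      (((-91/200 : ℚ)) : ℝ) ≤ p .tpOverT ∧ p .tpOverT ≤ (((-9/25 : ℚ)) : ℝ) ∧
      (((96/125 : ℚ)) : ℝ) ≤ p .filling ∧ p .filling ≤ (((391/500 : ℚ)) : ℝ) ∧
      (((959/2500 : ℚ)) : ℝ) ≤ p .tEV ∧ p .tEV ≤ (((293/625 : ℚ)) : ℝ) ∧
      ((0 : ℚ) : ℝ) ≤ p .tppOverT ∧ p .tppOverT ≤ ((0 : ℚ) : ℝ) := by
  constructor
  · intro h
    have h0 := (Entry.mem_ofEnds_iff _ _ _ _ _).1 (h .UOverT ndNiO2E_M21det_U rfl)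
    have h1 := (Entry.mem_ofEnds_iff _ _ _ _ _).1 (h .tpOverT ndNiO2E_M21det_tp rfl)
    have h2 := (Entry.mem_ofEnds_iff _ _ _ _ _).1 (h .filling ndSrNiO2E_M22det_n rfl)
    have h3 := (Entry.mem_ofEnds_iff _ _ _ _ _).1 (h .tEV ndNiO2E_M21det_t rfl)
    have h4 := (Entry.mem_ofEnds_iff _ _ _ _ _).1 (h .tppOverT ndNiO2E_M21_tpp rfl)
    exact ⟨h0.1, h0.2, h1.1, h1.2, h2.1, h2.2, h3.1, h3.2, h4.1, h4.2⟩
  · rintro ⟨a0, b0, a1, b1, a2, b2, a3, b3, a4, b4⟩ i e hi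
    cases i <;> simp only [boxNdSrNiO2E_M22det, Option.some.injEq, reduceCtorEq] at hi <;> subst hi
    exacts [(Entry.mem_ofEnds_iff _ _ _ _ _).2 ⟨a0, b0⟩, (Entry.mem_ofEnds_iff _ _ _ _ _).2 ⟨a1, b1⟩, (Entry.mem_ofEnds_iff _ _ _ _ _).2 ⟨a2, b2⟩,
      (Entry.mem_ofEnds_iff _ _ _ _ _).2 ⟨a3, b3⟩, (Entry.mem_ofEnds_iff _ _ _ _ _).2 ⟨a4, b4⟩]

/-- **`boxNdSrNiO2E_M22det ⊆ boxNdSrNiO2E_M22`** (`[0.768, 0.782] ⊆ [0.718, 0.818]`; the other rungs as for M21): every word on the M22 box of record — today's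
kinematic word `boxNdSrNiO2E_M22_stiffness_kinematic`, the twin leaf if it closes — transfers DOWN. [folklore] -/
theorem boxNdSrNiO2E_M22det_refines_M22 : boxNdSrNiO2E_M22det.Refines boxNdSrNiO2E_M22 := by
  intro p hp
  rw [boxNdSrNiO2E_M22det_mem_iff] at hp
  obtain ⟨a0, b0, a1, b1, a2, b2, a3, b3, a4, b4⟩ := hp
  rw [boxNdSrNiO2E_M22_mem_iff]
  push_cast at a0 b0 a1 b1 a2 b2 a3 b3 a4 b4 ⊢
  refine ⟨?_, ?_, ?_, ?_, ?_, ?_, ?_, ?_, a4, b4⟩ <;> linarith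

/-- Downward transfer: a word on `boxNdSrNiO2E_M22` holds on the M22 determination sub-box. [folklore] -/
theorem holdsOn_boxNdSrNiO2E_M22det_of_M22 {W : (OneBandCoord → ℝ) → Prop} (h : HoldsOn W boxNdSrNiO2E_M22) : HoldsOn W boxNdSrNiO2E_M22det :=
  h.of_refines boxNdSrNiO2E_M22det_refines_M22

/-- **Every un-padded M22 determination is a member of `boxNdSrNiO2E_M22det`**: `U` in the one-band hull, `t_eff` in the member hull, `U/t_eff = U / t_eff`,
`t′/t_eff` in the member hull, `n` equal to unc-3's band count `96/125` OR to the pocket reading `1 − 1/5 − 9/500`, `t″ = 0`. [folklore] -/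
theorem ndSrNiO2E_M22det_mem_of_determination (p : OneBandCoord → ℝ) {U : ℝ}
    (hU : U ∈ ndNiO2_oneBandU_hull.ratCast ℝ) (ht : p .tEV ∈ ndNiO2E_t_hull.ratCast ℝ) (hUt : p .UOverT = U / p .tEV)
    (htp : p .tpOverT ∈ ndNiO2E_tp_hull.ratCast ℝ)
    (hn : p .filling = ((ndNiO2Fill_count_x020 : ℚ) : ℝ) ∨ p .filling = (((1 - 1/5 - ndNiO2Fill_pocket_x020 : ℚ)) : ℝ))
    (htpp : p .tppOverT = 0) : boxNdSrNiO2E_M22det.Mem p := by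
  have hq := div_mem_Icc_ends (K := ℝ) (I := ndNiO2_oneBandU_hull) (T := ndNiO2E_t_hull)
    (by simp only [ndNiO2E_t_hull]; norm_num) (by simp only [ndNiO2_oneBandU_hull]; norm_num) hU ht
  simp only [ndNiO2_oneBandU_hull, ndNiO2E_t_hull, Set.mem_Icc] at hq
  rw [mem_ratCast_iff] at ht htp
  simp only [ndNiO2E_t_hull, ndNiO2E_tp_hull] at ht htp
  simp only [ndNiO2Fill_count_x020, ndNiO2Fill_pocket_x020] at hn
  rw [boxNdSrNiO2E_M22det_mem_iff, hUt, htpp]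
  push_cast at hq ht htp hn ⊢
  refine ⟨by linarith [hq.1], by linarith [hq.2], by linarith [htp.1], by linarith [htp.2], ?_, ?_,
    by linarith [ht.1], by linarith [ht.2], le_rfl, le_rfl⟩ <;> rcases hn with hn | hn <;> rw [hn] <;> norm_num

/-- Corners of the delivered S2 box of `boxNdSrNiO2E_M22det`: `(6175/1172, −91/200, 96/125)` / `(8000/959, −9/25, 391/500)`. [folklore] -/
theorem ndSrNiO2E_M22det_s2LoHi :
    s2Lo ndNiO2E_M21det_U ndNiO2E_M21det_tp ndSrNiO2E_M22det_n = ![6175/1172, -91/200, 96/125] ∧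
      s2Hi ndNiO2E_M21det_U ndNiO2E_M21det_tp ndSrNiO2E_M22det_n = ![8000/959, -9/25, 391/500] := by
  constructor <;> (ext i; fin_cases i <;> simp [s2Lo, s2Hi, ndNiO2E_M21det_U, ndNiO2E_M21det_tp, ndSrNiO2E_M22det_n])

/-- **Word door on `boxNdSrNiO2E_M22det`**: ANY predicate proved on `Set.Icc ![6175/1172, −91/200, 96/125] ![8000/959, −9/25, 391/500]` (order `(U/t, t′/t, n)`)
holds on the sub-box (e.g. a kinematic stiffness row at `c ≤ 0.4418857` ⇒ the padding-free M22 CONTROL word). [folklore] -/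
theorem boxNdSrNiO2E_M22det_word_of_s2Box {W : (Fin 3 → ℝ) → Prop}
    (hW : ∀ θ ∈ Set.Icc (![6175/1172, -91/200, 96/125] : Fin 3 → ℝ) ![8000/959, -9/25, 391/500], W θ) :
    HoldsOn (fun p : OneBandCoord → ℝ => W ![p .UOverT, p .tpOverT, p .filling]) boxNdSrNiO2E_M22det := by
  have h := holdsOn_of_forall_s2Box (B := boxNdSrNiO2E_M22det) (eU := ndNiO2E_M21det_U) (eS := ndNiO2E_M21det_tp)
    (eN := ndSrNiO2E_M22det_n) rfl rfl rfl (W := W) (by rw [ndSrNiO2E_M22det_s2LoHi.1, ndSrNiO2E_M22det_s2LoHi.2]; exact hW)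
  exact h

/-! ## §2 `boxNdSrNiO2E_M22res` — box-2's M22 residual corner cell as a sub-box -/

/-- `n ∈ [393/500, 409/500]` — the top of the M22 filling row left after the tree leaf `ndBoxE_sr025_stiffnessSeqLeaf` (`n ≤ 393/500 ⇒ 0.4414575 < bar`).
NOT an entry of record. [folklore] -/
def ndSrNiO2E_M22res_n : Entry := Entry.ofEnds (393/500) (409/500) (by norm_num) .screening

/-- **`boxNdSrNiO2E_M22res`** — cov-ndnio2-box-2's M22 residual corner cell `U/t ∈ [5, 17/2] × t′/t ∈ [−23/50, −11/25] × n ∈ [393/500, 409/500]`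
(`stiffnessBoxCeilingBelow_boxNdSrNiO2E_M22_of_cornerCellLeaf`), `t_eff`, `t″` verbatim from the box of record. NOT a box of record. [folklore] -/
def boxNdSrNiO2E_M22res : OneBandBox := fun c =>
  match c with
  | .UOverT => some ndSrNiO2E_M22_U
  | .tpOverT => some ndNiO2E_M21res_tp
  | .filling => some ndSrNiO2E_M22res_n
  | .tEV => some ndSrNiO2E_M22_t
  | .tppOverT => some ndSrNiO2E_M22_tpp
  | _ => none

/-- **Membership in `boxNdSrNiO2E_M22res` unfolded.** [folklore] -/
theorem boxNdSrNiO2E_M22res_mem_iff (p : OneBandCoord → ℝ) :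
    boxNdSrNiO2E_M22res.Mem p ↔
      ((5 : ℚ) : ℝ) ≤ p .UOverT ∧ p .UOverT ≤ (((17/2 : ℚ)) : ℝ) ∧
      (((-23/50 : ℚ)) : ℝ) ≤ p .tpOverT ∧ p .tpOverT ≤ (((-11/25 : ℚ)) : ℝ) ∧
      (((393/500 : ℚ)) : ℝ) ≤ p .filling ∧ p .filling ≤ (((409/500 : ℚ)) : ℝ) ∧
      (((19/50 : ℚ)) : ℝ) ≤ p .tEV ∧ p .tEV ≤ (((49/100 : ℚ)) : ℝ) ∧
      ((0 : ℚ) : ℝ) ≤ p .tppOverT ∧ p .tppOverT ≤ ((0 : ℚ) : ℝ) := by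
  constructor
  · intro h
    have h0 := (Entry.mem_ofEnds_iff _ _ _ _ _).1 (h .UOverT ndSrNiO2E_M22_U rfl)
    have h1 := (Entry.mem_ofEnds_iff _ _ _ _ _).1 (h .tpOverT ndNiO2E_M21res_tp rfl)
    have h2 := (Entry.mem_ofEnds_iff _ _ _ _ _).1 (h .filling ndSrNiO2E_M22res_n rfl)
    have h3 := (Entry.mem_ofEnds_iff _ _ _ _ _).1 (h .tEV ndSrNiO2E_M22_t rfl)
    have h4 := (Entry.mem_ofEnds_iff _ _ _ _ _).1 (h .tppOverT ndSrNiO2E_M22_tpp rfl)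
    exact ⟨h0.1, h0.2, h1.1, h1.2, h2.1, h2.2, h3.1, h3.2, h4.1, h4.2⟩
  · rintro ⟨a0, b0, a1, b1, a2, b2, a3, b3, a4, b4⟩ i e hi
    cases i <;> simp only [boxNdSrNiO2E_M22res, Option.some.injEq, reduceCtorEq] at hi <;> subst hi
    exacts [(Entry.mem_ofEnds_iff _ _ _ _ _).2 ⟨a0, b0⟩, (Entry.mem_ofEnds_iff _ _ _ _ _).2 ⟨a1, b1⟩, (Entry.mem_ofEnds_iff _ _ _ _ _).2 ⟨a2, b2⟩,
      (Entry.mem_ofEnds_iff _ _ _ _ _).2 ⟨a3, b3⟩, (Entry.mem_ofEnds_iff _ _ _ _ _).2 ⟨a4, b4⟩]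

/-- **`boxNdSrNiO2E_M22res ⊆ boxNdSrNiO2E_M22`** (two INWARD re-issues); a word on the cell alone is NOT the twin leaf — it needs box-2's kinematics on the rest
(`NdNiO2M22_StiffnessBoxCeiling_of_cornerCellLeaf`). [folklore] -/
theorem boxNdSrNiO2E_M22res_refines_M22 : boxNdSrNiO2E_M22res.Refines boxNdSrNiO2E_M22 := by
  intro p hp
  rw [boxNdSrNiO2E_M22res_mem_iff] at hp
  obtain ⟨a0, b0, a1, b1, a2, b2, a3, b3, a4, b4⟩ := hp
  rw [boxNdSrNiO2E_M22_mem_iff]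
  push_cast at a0 b0 a1 b1 a2 b2 a3 b3 a4 b4 ⊢
  refine ⟨a0, b0, a1, ?_, ?_, b2, a3, b3, a4, b4⟩ <;> linarith

/-- Corners of the delivered S2 box of `boxNdSrNiO2E_M22res`: `(5, −23/50, 393/500)` / `(17/2, −11/25, 409/500)`. [folklore] -/
theorem ndSrNiO2E_M22res_s2LoHi :
    s2Lo ndSrNiO2E_M22_U ndNiO2E_M21res_tp ndSrNiO2E_M22res_n = ![5, -23/50, 393/500] ∧
      s2Hi ndSrNiO2E_M22_U ndNiO2E_M21res_tp ndSrNiO2E_M22res_n = ![17/2, -11/25, 409/500] := by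
  constructor <;> (ext i; fin_cases i <;> simp [s2Lo, s2Hi, ndSrNiO2E_M22_U, ndNiO2E_M21res_tp, ndSrNiO2E_M22res_n])

/-- **Word door on `boxNdSrNiO2E_M22res`, curried CELL form** — box-2's M22 corner-cell hypothesis shape `∀ tp ∈ Icc (−23/50) (−11/25), ∀ U ∈ Icc 5 (17/2),
∀ n ∈ Icc (393/500) (409/500), W tp U n` ⇒ the word holds on the typed cell. [folklore] -/
theorem boxNdSrNiO2E_M22res_word_of_cell {W : ℝ → ℝ → ℝ → Prop}
    (hW : ∀ tp ∈ Set.Icc (-23/50 : ℝ) (-11/25), ∀ U ∈ Set.Icc (5 : ℝ) (17/2), ∀ n ∈ Set.Icc (393/500 : ℝ) (409/500), W tp U n) :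
    HoldsOn (fun p : OneBandCoord → ℝ => W (p .tpOverT) (p .UOverT) (p .filling)) boxNdSrNiO2E_M22res := by
  intro p hp
  rw [boxNdSrNiO2E_M22res_mem_iff] at hp
  obtain ⟨a0, b0, a1, b1, a2, b2, -, -, -, -⟩ := hp
  push_cast at a0 b0 a1 b1 a2 b2
  exact hW _ ⟨a1, b1⟩ _ ⟨a0, b0⟩ _ ⟨a2, b2⟩

/-! ## §3 THE M22 RESIDUAL CELL IS PADDING-ONLY: `boxNdSrNiO2E_M22res ∩ boxNdSrNiO2E_M22det = ∅` -/

/-- **DISJOINTNESS**: no parameter vector lies in both the M22 residual corner cell and the M22 determination hull — the cell's fillings start at `393/500`,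
ABOVE every `n` determination (`≤ 391/500`). So, unlike M21 (sequel C: an admitted determination inside EACH residual slab), **everything the twin leaf
«MOS2-ndnio2-M22» asks of a solver on its residual cell concerns INFL-dop class-floor padding of the `n` row, not any admitted determination**. [folklore] -/
theorem ndSrNiO2E_M22_res_disjoint_det (p : OneBandCoord → ℝ) (hres : boxNdSrNiO2E_M22res.Mem p) : ¬ boxNdSrNiO2E_M22det.Mem p := by
  intro hdet
  rw [boxNdSrNiO2E_M22res_mem_iff] at hres
  rw [boxNdSrNiO2E_M22det_mem_iff] at hdet
  obtain ⟨-, -, -, -, a2, -, -, -, -, -⟩ := hres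
  obtain ⟨-, -, -, -, -, b2, -, -, -, -⟩ := hdet
  push_cast at a2 b2
  linarith

/-- **The exact gaps**: from the determination hull to the residual cell's bottom `393/500`: `1/250` above the pocket reading `391/500`, `9/500` above the
band-count member of record `96/125`; and to the M22 binding corner `(U/t, t′/t, n) = (5, −23/50, 409/500)`: `Δt′/t = 1/200`, `Δn = 9/250` (to `391/500`;
`1/20` = the whole class floor to the member `96/125`), `ΔU/t = 315/1172`. [folklore] -/
theorem ndSrNiO2E_M22_det_gaps :
    ndSrNiO2E_M22res_n.encl.fst - ndSrNiO2E_M22det_n.encl.snd = 1/250 ∧ ndSrNiO2E_M22res_n.encl.fst - ndSrNiO2E_M22det_n.encl.fst = 9/500 ∧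
      ndNiO2E_M21det_tp.encl.fst - ndSrNiO2E_M22_tp.encl.fst = 1/200 ∧
      ndSrNiO2E_M22_n.encl.snd - ndSrNiO2E_M22det_n.encl.snd = 9/250 ∧ ndSrNiO2E_M22_n.encl.snd - ndSrNiO2E_M22det_n.encl.fst = 1/20 ∧
      ndNiO2E_M21det_U.encl.fst - ndSrNiO2E_M22_U.encl.fst = 315/1172 := by
  simp only [ndSrNiO2E_M22res_n, ndSrNiO2E_M22det_n, ndNiO2E_M21det_tp, ndSrNiO2E_M22_tp, ndSrNiO2E_M22_n, ndNiO2E_M21det_U, ndSrNiO2E_M22_U,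
    Entry.encl_ofEnds_fst, Entry.encl_ofEnds_snd]; norm_num

/-- Every point of `boxNdSrNiO2E_M22det` keeps these distances from the M22 binding corner: `t′/t ≥ −23/50 + 1/200`, `n ≤ 409/500 − 9/250`,
`U/t ≥ 5 + 315/1172`. [folklore] -/
theorem ndSrNiO2E_M22det_gaps_to_bindingCorner (p : OneBandCoord → ℝ) (hp : boxNdSrNiO2E_M22det.Mem p) :
    (-23/50 : ℝ) + 1/200 ≤ p .tpOverT ∧ p .filling ≤ (409/500 : ℝ) - 9/250 ∧ (5 : ℝ) + 315/1172 ≤ p .UOverT := by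
  rw [boxNdSrNiO2E_M22det_mem_iff] at hp
  obtain ⟨a0, -, a1, -, -, b2, -, -, -, -⟩ := hp
  push_cast at a0 a1 b2
  refine ⟨by linarith, by linarith, by linarith⟩

end Summit.Ventures.CertifiedManyBodySolver.Downfold

end
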